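import Summits.HubbardSuperconductivity.HubbardSuperconductivity.Theorems.AnisotropyChordTransferFibre3FinXC2Eval
import Summits.HubbardSuperconductivity.HubbardSuperconductivity.Theorems.AnisotropyChordTransferFibre3FinXC2P24bo
import Summits.HubbardSuperconductivity.HubbardSuperconductivity.Theorems.AnisotropyChordTransferFibre3FinXC2P24bp

/-!
# Route `AnisotropyChord` / H0 rotor rung: FIN XBC2 combined (rows `N₁` + C) certificate at `L = 24` — cell facts, part `bo`

Kernel facts `xbcCellAny2 24 (49/50) 20 la lb (c, bn) = true` (evaluator `…FinXC2Eval` on `…FinXB2Eval`, point wedges rewritten to certified literal tables `…FinXC2P24*`) for 1 λ-cell(s)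
(`…FinXC2Eval.xbcCheck2`; cell design: g5 `xbc_design.py` (≤ 2.5 % cells, b = bn/20 ≥ 1.04·b_cell), mirrors `xb_mirror.py`/`xc_mirror.py`); assembled in `…FinXC2TwentyFour`.
Prover seat `hubbard-h0-rotor-p3` g6; helper for piece A = stmt-HubbardSuperconductivity-23918 of rung 19089 (`--supports`, helper class).
WHAT THIS IS NOT: nothing here proves superconductivity in the Hubbard model (rotor TARGET as worded stays FALSE, g15 verdict); kernel facts for the FIN certificate of TWO hypotheses (rows `N₁`, C) of ONE conditional reduction.  Tree imports only; no sorry, no new axioms.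
-/

set_option linter.dupNamespace false

namespace Summit.HubbardSuperconductivity.HubbardSuperconductivity.Theorems.AnisotropyChord.Transfer.Fibre3

namespace FinXB

set_option maxHeartbeats 4000000 in
/-- kernel fact: cell 81 at `L = 24` (certified, (c, bn) = ((11/20 : ℚ), 13)). [folklore] -/
theorem xbc2c24_81 : xbcCellAny2 24 (49/50 : ℚ) 20 687375709970256 704560102719513 ((11/20 : ℚ), (13 : ℕ)) = true := by
  unfold xbcCellAny2
  rw [twc24_66_eq, twc24_67_eq]
  decide +kernel

end FinXB

end Summit.HubbardSuperconductivity.HubbardSuperconductivity.Theorems.AnisotropyChord.Transfer.Fibre3
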